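import Summits.BirchSwinnertonDyer.Rank1Residual.X2.LocalInertiaCohomologyMultiplicative
import HarnessLib

/-!
# Frobenius-stable `p`-torsion classes of `H¹(I_v, E[p^∞])` VANISH at a multiplicative `v ∤ p` with
# `ℓ ≢ a_v (mod p)` (Greenberg–Vatsal §2 Prop. (2.4), inertia side, case `d_ℓ = 0`) — cell
# `b2b-bsdres`, unit `b2b-bsdres-eisenstein-p2`, gen 30 (sequel of `LocalInertiaCohomologyMultiplicative`)

HONEST FRAMING (run/shared/lean/b2b/bsd-rank1-residual/, verbatim in every file): the goal of the
cell is to DELETE the COMBINATION-SHAPED residual classes of the Birch–Swinnerton-Dyer formula for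
ALL analytic-rank `≤ 1` elliptic curves over `ℚ` — "full BSD formula for every rank `≤ 1` curve in
class `C`" assembled STRICTLY from published theorems — so that the rank-`≤ 1` remainder becomes
exactly the CONSTRUCTION-SHAPED classes, which are TYPED (missing-input `Prop`s), NOT attempted.
This is not "finishing BSD". Research route (programme P1 of X2-GAP §34 = the UPPER HALF of
Greenberg–Vatsal's Cor. (2.3)/Prop. (2.4) in the kernel); NO CLAIM BEYOND STATED CLASSES; nothing
here changes a label. Theorems only; no definition, no named fact, no `sorry`.

Setting as in `LocalInertiaCohomologyMultiplicative` (`E/K`, prime `p`, a place `v ∤ p` of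
multiplicative reduction, a TWISTED Tate parametrisation `Ψ, t, q` with inertia fixing `t`, and a
subgroup `H ≤ Γ_K` containing the global inertia group `I_v`). Here:

* §2′ `natCard_torsionBy_discreteH1_inertiaIn_le` — the `Nat.card`/finiteness form of
  `card_le_of_prime_nsmul_eq_zero`: `H¹(H ∩ I_v, E[p^∞])[p]` is finite of order `≤ p`;
* §3 **`resH1Hom_inertiaIn_eq_zero_of_prime_nsmul_eq_zero`**: if `H` contains the restriction of
  every element of `Γ_{K_v}` killed by all continuous `Γ_{K_v} → ℤ_p` (e.g. `H = ker κ` for a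
  `ℤ_p`-extension `κ`: `…_kerSubgroup`), `p` is odd, `t² ∈ K_v`, and `p ∤ q_v − χ(φ)` for an
  arithmetic Frobenius `φ` (`χ(φ) = ±1` its sign on `t`, i.e. `a_v`), then every class of
  `H¹(H, E[p^∞])` whose restriction to `H ∩ I_v` is `p`-torsion restricts to ZERO — the case
  `d_v = 0` ("`ℓ ≢ a_ℓ (mod p)`") of GV's Prop. (2.4): the `v`-component of `S^{Σ₀}_A/S_A` has no
  `p`-torsion, hence vanishes.

Method: inflate along `absInertia K_v ↠ H ∩ I_v` (injective on `H¹`) and apply the abstract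
`LocalInertiaTateQuotient.oneCocycleClass_eq_zero_of_conj` to a cocycle `F` of the class restricted
along `absInertia K_v → H`, with `g` the prime-to-`p` part of `φ` (`FrobeniusPrimeToPPart`:
`res g ∈ H`), `a₀ = F(res g)` (cocycle identity `g•F(g⁻¹σg) − F(σ) = σ•F(g) − F(g)`), and the scalar
`χ(g) = χ(φ)` by which `g` acts on `A/C` (`smul_sub_sign_smul_mem`; `p` odd).

References: [GreenbergVatsal2000] §2 pp. 14–15, Prop. (2.4) pp. 22–23; [Greenberg1989] §2 Prop. 2;
[SilvermanATAEC1994] V.3.1, V.5.2–5.4; HOME X2-GAP.md §34.6.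
-/

set_option autoImplicit false

noncomputable section

open scoped Classical NNReal AddSubgroup

open CategoryTheory Function Filter NumberField IsDedekindDomain Field ValuativeRel
open Literature.NumberTheory.EllipticCurves Literature.NumberTheory.EllipticCurves.GreenbergSelmer
  Literature.NumberTheory.GaloisRepresentations
  Literature.NumberTheory.GaloisRepresentations.IsNonarchimedeanLocalField
  IsDedekindDomain.HeightOneSpectrum
  Summit.BirchSwinnertonDyer.Rank1Residual.X11b.LocBridge
  Summit.BirchSwinnertonDyer.Rank1Residual.X2.GreenbergVatsalTateDatum
  Summit.BirchSwinnertonDyer.Rank1Residual.X2.GreenbergVatsalTateDatumSign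
  Summit.BirchSwinnertonDyer.Rank1Residual.X2.GreenbergVatsalTateDatumCofree
  Summit.BirchSwinnertonDyer.Rank1Residual.X2.LocalInertiaTateQuotient

universe u

namespace Summit.BirchSwinnertonDyer.Rank1Residual.X2.LocalInertiaCohomologyMultiplicative

variable {K : Type u} [Field K] [NumberField K] (W : WeierstrassCurve K) (p : ℕ) [hp : Fact p.Prime]
  {v : HeightOneSpectrum (𝓞 K)}
  (Ψ : Additive (AlgebraicClosure (v.adicCompletion K))ˣ →+ localPoints W (v.adicCompletion K))
  (t : AlgebraicClosure (v.adicCompletion K))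
  (hΨσ : ∀ (σ : absoluteGaloisGroup (v.adicCompletion K))
      (u : (AlgebraicClosure (v.adicCompletion K))ˣ),
    σ • Ψ (Additive.ofMul u) =
      (if Field.absoluteGaloisGroup.toAlgEquiv (v.adicCompletion K) σ t = t then (1 : ℤ)
        else -1) •
      Ψ (Additive.ofMul (Units.map
        (Field.absoluteGaloisGroup.toAlgEquiv (v.adicCompletion K) σ :
          AlgebraicClosure (v.adicCompletion K) →* AlgebraicClosure (v.adicCompletion K)) u)))
  (hsurj : Function.Surjective Ψ) {q : v.adicCompletion K} (hq0 : q ≠ 0) (hq1 : Valued.v q < 1)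
  (hker : ∀ u : (AlgebraicClosure (v.adicCompletion K))ˣ, Ψ (Additive.ofMul u) = 0 →
    ∃ a : ℤ, (u : AlgebraicClosure (v.adicCompletion K)) =
      algebraMap (v.adicCompletion K) (AlgebraicClosure (v.adicCompletion K)) q ^ a)
  (ht : ∀ σ ∈ absInertia (v.adicCompletion K),
    Field.absoluteGaloisGroup.toAlgEquiv (v.adicCompletion K) σ t = t)
  (hpv : ((p : ℕ) : 𝓞 K) ∉ v.asIdeal)

variable [W.IsElliptic]

/-! ## §2′. `#H¹(H ∩ I_v, E[p^∞])[p] ≤ p`: the `Nat.card` form -/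

section Bound

variable (H : Subgroup (absoluteGaloisGroup K))

include Ψ t hΨσ hsurj hq0 hq1 hker ht hpv in
/-- `Nat.card`/finiteness form of `card_le_of_prime_nsmul_eq_zero`: the `p`-torsion subgroup
`H¹(H ∩ I_v, E[p^∞])[p]` is finite of order `≤ p`. [cite: GreenbergVatsal2000, §2 Prop. (2.4) pp. 22–23] -/
theorem natCard_torsionBy_discreteH1_inertiaIn_le (hmult : W.HasMultiplicativeReductionAt v)
    (hIH : inertia v ≤ H) :
    Finite ((discreteH1 (inertiaIn H v) (W.geomPrimaryTorsion p))[(p : ℤ)]) ∧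
      Nat.card ((discreteH1 (inertiaIn H v) (W.geomPrimaryTorsion p))[(p : ℤ)]) ≤ p := by
  have key := card_le_of_prime_nsmul_eq_zero W p Ψ t hΨσ hsurj hq0 hq1 hker ht hpv H hmult hIH
  have hmem : ∀ x : (discreteH1 (inertiaIn H v) (W.geomPrimaryTorsion p))[(p : ℤ)],
      p • (x : discreteH1 (inertiaIn H v) (W.geomPrimaryTorsion p)) = 0 := fun x ↦
    AddSubgroup.torsionBy.nsmul_iff.1 x.2
  have hfin : Finite ((discreteH1 (inertiaIn H v) (W.geomPrimaryTorsion p))[(p : ℤ)]) := by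
    by_contra hinf
    rw [not_finite_iff_infinite] at hinf
    obtain ⟨s, hs⟩ := Infinite.exists_subset_card_eq
      ((discreteH1 (inertiaIn H v) (W.geomPrimaryTorsion p))[(p : ℤ)]) (p + 1)
    have h := key (s.map (Function.Embedding.subtype _)) (fun x hx ↦ by
      obtain ⟨y, -, rfl⟩ := Finset.mem_map.1 hx
      exact hmem y)
    rw [Finset.card_map, hs] at h
    omega
  refine ⟨hfin, ?_⟩
  haveI := Fintype.ofFinite ((discreteH1 (inertiaIn H v) (W.geomPrimaryTorsion p))[(p : ℤ)])
  have h := key ((Finset.univ : Finset ((discreteH1 (inertiaIn H v) (W.geomPrimaryTorsion p))[(p : ℤ)])).map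
    (Function.Embedding.subtype _)) (fun x hx ↦ by
      obtain ⟨y, -, rfl⟩ := Finset.mem_map.1 hx
      exact hmem y)
  rwa [Finset.card_map, Finset.card_univ, ← Nat.card_eq_fintype_card] at h

end Bound

/-! ## §3. Frobenius-stable `p`-torsion classes vanish when `p ∤ q_v − χ(φ)` -/

section Vanishing

variable (H : Subgroup (absoluteGaloisGroup K))

omit hp in
/-- `σ • t = ±t` for every `σ ∈ Γ_{K_v}` when `t² ∈ K_v`. [folklore] -/
theorem smul_sqrt_eq_or_eq_neg {γ : v.adicCompletion K}
    (ht2 : t ^ 2 = algebraMap (v.adicCompletion K) (AlgebraicClosure (v.adicCompletion K)) γ)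
    (σ : absoluteGaloisGroup (v.adicCompletion K)) : σ • t = t ∨ σ • t = -t := by
  have hsq : (σ • t) ^ 2 = t ^ 2 := by
    rw [Field.absoluteGaloisGroup.smul_def, ← map_pow, ht2, AlgEquiv.commutes]
  have h0 : (σ • t - t) * (σ • t + t) = 0 := by
    have : (σ • t - t) * (σ • t + t) = (σ • t) ^ 2 - t ^ 2 := by ring
    rw [this, hsq, sub_self]
  rcases mul_eq_zero.mp h0 with h | h
  · exact Or.inl (sub_eq_zero.mp h)
  · exact Or.inr (eq_neg_of_add_eq_zero_left h)

/-- **The prime-to-`p` part `g` of a Frobenius `φ` acts on `t` as `φ` does** (`p` odd): every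
`φ^{p^{k!}}` does (`p^{k!}` is odd and `φ t = ±t`), and `{σ | σ t = φ t}` is closed.
[cite: GreenbergVatsal2000, §2 Prop. (2.4)] -/
theorem smul_sqrt_eq_of_mapClusterPt (hp2 : p ≠ 2) {γ : v.adicCompletion K}
    (ht2 : t ^ 2 = algebraMap (v.adicCompletion K) (AlgebraicClosure (v.adicCompletion K)) γ)
    {φ g : absoluteGaloisGroup (v.adicCompletion K)}
    (hg : MapClusterPt g atTop (fun k : ℕ => φ ^ p ^ k.factorial)) : g • t = φ • t := by
  have hodd : ∀ k : ℕ, Odd (p ^ k.factorial) := fun k ↦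
    (hp.out.eq_two_or_odd'.resolve_left hp2).pow
  have hpow : ∀ n : ℕ, Odd n → φ ^ n • t = φ • t := by
    intro n hn
    rcases smul_sqrt_eq_or_eq_neg t ht2 φ with h | h
    · -- `φ` fixes `t`, hence so does every power
      have : ∀ m : ℕ, φ ^ m • t = t := by
        intro m
        induction m with
        | zero => rw [pow_zero, one_smul]
        | succ m ih => rw [pow_succ, mul_smul, h, ih]
      rw [this, h]
    · have : ∀ m : ℕ, φ ^ m • t = (-1) ^ m * t := by
        intro m
        induction m with
        | zero => rw [pow_zero, one_smul, pow_zero, one_mul]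
        | succ m ih => rw [pow_succ, mul_smul, h, smul_neg, ih, pow_succ]; ring
      rw [this, h, hn.neg_one_pow, neg_one_mul]
  have hclosed := RootOfUnityAction.isClosed_setOf_smul_eq (K := v.adicCompletion K) t (φ • t)
  exact MapClusterPt.mem_of_isClosed_of_eventually hg hclosed
    (Eventually.of_forall fun k ↦ hpow _ (hodd k))

include Ψ hΨσ hsurj hq0 hq1 hker ht hpv in
/-- **Frobenius-stable `p`-torsion classes of `H¹(H ∩ I_v, E[p^∞])` coming from `H¹(H, E[p^∞])`
VANISH when `p ∤ q_v − χ(φ)`** (`p` odd, `v ∤ p` multiplicative, `I_v ≤ H`, and `H` containing the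
restriction of every element of `Γ_{K_v}` killed by all continuous `Γ_{K_v} → ℤ_p` — e.g.
`H = Gal(K̄/K_∞)` for a `ℤ_p`-extension). Precisely: for `c ∈ H¹(H, E[p^∞])` with
`p • res_{H ∩ I_v} c = 0` one has `res_{H ∩ I_v} c = 0`. Proof: inflate to `absInertia K_v`
(injective) and apply the abstract `oneCocycleClass_eq_zero_of_conj` to a cocycle `F` of `c`
restricted along `absInertia K_v → H`, with `g` the prime-to-`p` part of `φ`
(`FrobeniusPrimeToPPart`; `res g ∈ H`), `a₀ = F(res g)` (cocycle identity
`g•F(g⁻¹σg) − F(σ) = σ•F(g) − F(g)`), and the scalar `a = χ(g) = χ(φ) = ±1` by which `g` acts on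
`A/C` (`smul_sub_sign_smul_mem`, `smul_sqrt_eq_of_mapClusterPt`). This is the case `d_v = 0`
("`ℓ ≢ a_ℓ (mod p)`": `P_v = 1 − a_v ℓ^{-s}`, `a_v = χ(Frob_v)`) of GV's Prop. (2.4) on the
inertia side. [cite: GreenbergVatsal2000, §2 Prop. (2.4) pp. 22–23] [cite: Greenberg1989, §2 Prop. 2] -/
theorem resH1Hom_inertiaIn_eq_zero_of_prime_nsmul_eq_zero (hp2 : p ≠ 2)
    (hmult : W.HasMultiplicativeReductionAt v) (hIH : inertia v ≤ H)
    (hH : ∀ g : absoluteGaloisGroup (v.adicCompletion K),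
      (∀ χ : absoluteGaloisGroup (v.adicCompletion K) →ₜ* Multiplicative ℤ_[p], χ g = 1) →
      absGaloisRestrict K (v.adicCompletion K) g ∈ H)
    {γ : v.adicCompletion K}
    (ht2 : t ^ 2 = algebraMap (v.adicCompletion K) (AlgebraicClosure (v.adicCompletion K)) γ)
    {φ : absoluteGaloisGroup (v.adicCompletion K)} (hφ : IsFrobPow φ 1)
    (hcong : ¬ ((p : ℤ) ∣ (residueFieldCard (v.adicCompletion K) : ℤ) -
      (if Field.absoluteGaloisGroup.toAlgEquiv (v.adicCompletion K) φ t = t then 1 else -1)))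
    (c : subgroupH1 H (W.geomPrimaryTorsion p))
    (hpc : p • resH1Hom (inertiaInToH H v) (AddMonoidHom.id (W.geomPrimaryTorsion p))
      (fun _ _ ↦ rfl) c = 0) :
    resH1Hom (inertiaInToH H v) (AddMonoidHom.id (W.geomPrimaryTorsion p)) (fun _ _ ↦ rfl) c = 0 := by
  haveI : CompactSpace (absoluteGaloisGroup (v.adicCompletion K)) :=
    absoluteGaloisGroup_compactSpace (v.adicCompletion K)
  -- the surjection `θ : absInertia K_v ↠ H ∩ I_v` and the injectivity of inflation along it
  let θ : absInertia (v.adicCompletion K) →ₜ* inertiaIn H v :=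
    { toFun := fun σ ↦ ⟨⟨absGaloisRestrict K (v.adicCompletion K) σ, ⟨σ, rfl⟩⟩,
        (mem_inertiaIn_iff H v _).2
          ⟨hIH (Subgroup.mem_map_of_mem _ σ.2), Subgroup.mem_map_of_mem _ σ.2⟩⟩
      map_one' := Subtype.ext (Subtype.ext (by simp))
      map_mul' := fun x y ↦ Subtype.ext (Subtype.ext (by simp))
      continuous_toFun := by
        refine Continuous.subtype_mk (Continuous.subtype_mk ?_ _) _
        exact (absGaloisRestrict K (v.adicCompletion K)).continuous_toFun.comp continuous_subtype_val }
  have hθ : Function.Surjective θ := by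
    intro x
    obtain ⟨σ, hσ, hσx⟩ := Subgroup.mem_map.1 ((mem_inertiaIn_iff H v x.1).1 x.2).2
    exact ⟨⟨σ, hσ⟩, Subtype.ext (Subtype.ext hσx)⟩
  set ρ : ContinuousRep (absoluteGaloisGroup (v.adicCompletion K)) ℤ (W.geomPrimaryTorsion p) :=
    (primaryGaloisModule W p).restrict (absGaloisRestrict K (v.adicCompletion K)) with hρ
  set C : Submodule ℤ (W.geomPrimaryTorsion p) :=
    AddSubgroup.toIntSubmodule (tateDatum W p Ψ (sign_disj W Ψ t hΨσ)).plus with hCdef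
  have hC : ∀ g : absoluteGaloisGroup (v.adicCompletion K), C ≤ C.comap (ρ g) :=
    plus_le_comap W p Ψ t hΨσ
  have hinj := map_one_injective_of_surjective
    (discreteTopRep (inertiaIn H v) (W.geomPrimaryTorsion p)) θ hθ
  -- the prime-to-`p` part `g` of `φ`; its restriction lies in `H`
  obtain ⟨g, hg⟩ := exists_mapClusterPt_pow_prime_pow_factorial φ p
  have hgH : absGaloisRestrict K (v.adicCompletion K) g ∈ H :=
    hH g fun χ ↦ map_eq_one_of_mapClusterPt χ hg
  have hgt : Field.absoluteGaloisGroup.toAlgEquiv (v.adicCompletion K) g t =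
      Field.absoluteGaloisGroup.toAlgEquiv (v.adicCompletion K) φ t := by
    rw [← Field.absoluteGaloisGroup.smul_def, ← Field.absoluteGaloisGroup.smul_def]
    exact smul_sqrt_eq_of_mapClusterPt p t hp2 ht2 hg
  -- a cocycle of `c`, its restriction to `H ∩ I_v`, and the inflation to `absInertia K_v`
  obtain ⟨F, rfl⟩ := oneCocycleClass_surjective _ c
  rw [resH1Hom_oneCocycleClass] at hpc ⊢
  set F' := contOneCocycles.pullback (inertiaInToH H v)
    (resHomOfEquivariant (inertiaInToH H v) (AddMonoidHom.id (W.geomPrimaryTorsion p))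
      (fun _ _ ↦ rfl)) F with hF'
  set f := contOneCocycles.pullback θ
    (𝟙 (TopRep.res (θ : absInertia (v.adicCompletion K) →* inertiaIn H v)
      (discreteTopRep (inertiaIn H v) (W.geomPrimaryTorsion p)))) F' with hf
  suffices hf0 : oneCocycleClass (TopRep.res (θ : absInertia (v.adicCompletion K) →* inertiaIn H v)
      (discreteTopRep (inertiaIn H v) (W.geomPrimaryTorsion p))) f = 0 by
    apply hinj
    rw [map_oneCocycleClass, map_zero]
    exact hf0
  -- values of `f`
  have hfval : ∀ σ : absInertia (v.adicCompletion K),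
      f.1 σ = F.1 ⟨absGaloisRestrict K (v.adicCompletion K) σ,
        hIH (Subgroup.mem_map_of_mem _ σ.2)⟩ := by
    intro σ
    rfl
  -- `p • [f] = 0`
  have hpf : p • oneCocycleClass (TopRep.res (θ : absInertia (v.adicCompletion K) →* inertiaIn H v)
      (discreteTopRep (inertiaIn H v) (W.geomPrimaryTorsion p))) f = 0 := by
    have h0 := congrArg (ContinuousCohomology.map θ
      (𝟙 (TopRep.res (θ : absInertia (v.adicCompletion K) →* inertiaIn H v)
        (discreteTopRep (inertiaIn H v) (W.geomPrimaryTorsion p)))) 1) hpc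
    rw [map_nsmul, map_zero, map_oneCocycleClass] at h0
    exact h0
  -- the elements `G = res g`, `Sσ = res σ` of `H`
  let G : H := ⟨absGaloisRestrict K (v.adicCompletion K) g, hgH⟩
  haveI := finite_torsionBy_curve W p
  haveI : Finite (Submodule.torsionBy ℤ (W.geomPrimaryTorsion p ⧸ C) (p : ℤ)) :=
    finite_torsionBy_quotient_plus W p Ψ t hΨσ hq0 hq1 hker
  -- the abstract lemma, on `H¹(absInertia K_v, ρ|) = H¹(absInertia K_v, res_θ A)` (definitionally)
  refine oneCocycleClass_eq_zero_of_conj (v.adicCompletion K) ρ C hC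
    (by have h := pow_coprime_ringChar p hpv 1; rwa [pow_one] at h)
    (fun σ hσ c hc ↦ smul_eq_self_of_mem_absInertia_of_mem_plus W p Ψ t hΨσ hq0 hq1 hker ht hpv hσ hc)
    (fun σ hσ a ↦ smul_sub_mem_plus_of_mem_absInertia W p Ψ t hΨσ hsurj hker ht hσ a)
    (tateDatum_plus_divisible W p Ψ (sign_disj W Ψ t hΨσ)) (GreenbergVatsalTorsionCurve.divisible_curve W p)
    (primary_curve W p) (hCp := (natCard_torsionBy_plus W p Ψ t hΨσ hq0 hq1 hker).le)
    (hmove := exists_mem_absInertia_smul_ne W p hpv hmult) hφ hg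
    (if Field.absoluteGaloisGroup.toAlgEquiv (v.adicCompletion K) φ t = t then 1 else -1)
    ?_ hcong f hpf ⟨F.1 G, fun σ ↦ ?_⟩
  · -- `g` acts on `A/C` by the sign `χ(g) = χ(φ)`
    intro d _
    induction d using Submodule.Quotient.induction_on with
    | _ x =>
      rw [ContinuousRep.quotient_apply_mk, ← hgt]
      have hmem := smul_sub_sign_smul_mem W p Ψ t hΨσ hsurj hker g x
      have hq : ∀ (n : ℤ) (y : W.geomPrimaryTorsion p),
          (n • Submodule.Quotient.mk y : W.geomPrimaryTorsion p ⧸ C) = Submodule.Quotient.mk (n • y) :=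
        fun n y ↦ (map_zsmul (Submodule.mkQ C) n y).symm
      rw [← sub_eq_zero, hq, ← Submodule.Quotient.mk_sub, Submodule.Quotient.mk_eq_zero]
      exact hmem
  · -- the cocycle identity `g•F(g⁻¹σg) − F(σ) = σ•F(g) − F(g)`
    let Sσ : H := ⟨absGaloisRestrict K (v.adicCompletion K) σ, hIH (Subgroup.mem_map_of_mem _ σ.2)⟩
    have hconj : f.1 ⟨g⁻¹ * (σ : absoluteGaloisGroup (v.adicCompletion K)) * g,
        (inferInstance : (absInertia (v.adicCompletion K)).Normal).conj_mem' _ σ.2 g⟩ =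
        F.1 (G⁻¹ * Sσ * G) := by
      rw [hfval]
      congr 1
      refine Subtype.ext ?_
      change absGaloisRestrict K (v.adicCompletion K)
          (g⁻¹ * (σ : absoluteGaloisGroup (v.adicCompletion K)) * g) = _
      rw [map_mul, map_mul, map_inv]
      rfl
    have h1 := F.2 G (G⁻¹ * Sσ * G)
    have hmulG : G * (G⁻¹ * Sσ * G) = Sσ * G := by group
    rw [hmulG] at h1
    have h2 := F.2 Sσ G
    rw [hconj, hfval σ]
    change (absGaloisRestrict K (v.adicCompletion K) g) • F.1 (G⁻¹ * Sσ * G) - F.1 Sσ =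
      (absGaloisRestrict K (v.adicCompletion K) σ) • F.1 G - F.1 G
    have h1' : F.1 (Sσ * G) =
        F.1 G + (absGaloisRestrict K (v.adicCompletion K) g) • F.1 (G⁻¹ * Sσ * G) := h1
    have h2' : F.1 (Sσ * G) = F.1 Sσ + (absGaloisRestrict K (v.adicCompletion K) σ) • F.1 G := h2
    have e1 : (absGaloisRestrict K (v.adicCompletion K) g) • F.1 (G⁻¹ * Sσ * G) =
        F.1 (Sσ * G) - F.1 G := by rw [h1']; abel
    have e2 : (absGaloisRestrict K (v.adicCompletion K) σ) • F.1 G = F.1 (Sσ * G) - F.1 Sσ := by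
      rw [h2']; abel
    rw [e1, e2]
    abel

include Ψ hΨσ hsurj hq0 hq1 hker ht hpv in
/-- The `H = ker κ` spelling of `resH1Hom_inertiaIn_eq_zero_of_prime_nsmul_eq_zero` for a
`ℤ_p`-extension `κ` unramified at `v` (`I_v ≤ ker κ`): the prime-to-`p` part of a Frobenius is
killed by `κ ∘ res`. [cite: GreenbergVatsal2000, §2 Prop. (2.4) pp. 22–23] -/
theorem resH1Hom_inertiaIn_eq_zero_of_prime_nsmul_eq_zero_kerSubgroup (κ : ZpExtension K p)
    (hp2 : p ≠ 2) (hmult : W.HasMultiplicativeReductionAt v) (hIH : inertia v ≤ κ.kerSubgroup)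
    {γ : v.adicCompletion K}
    (ht2 : t ^ 2 = algebraMap (v.adicCompletion K) (AlgebraicClosure (v.adicCompletion K)) γ)
    {φ : absoluteGaloisGroup (v.adicCompletion K)} (hφ : IsFrobPow φ 1)
    (hcong : ¬ ((p : ℤ) ∣ (residueFieldCard (v.adicCompletion K) : ℤ) -
      (if Field.absoluteGaloisGroup.toAlgEquiv (v.adicCompletion K) φ t = t then 1 else -1)))
    (c : subgroupH1 κ.kerSubgroup (W.geomPrimaryTorsion p))
    (hpc : p • resH1Hom (inertiaInToH κ.kerSubgroup v) (AddMonoidHom.id (W.geomPrimaryTorsion p))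
      (fun _ _ ↦ rfl) c = 0) :
    resH1Hom (inertiaInToH κ.kerSubgroup v) (AddMonoidHom.id (W.geomPrimaryTorsion p))
      (fun _ _ ↦ rfl) c = 0 :=
  resH1Hom_inertiaIn_eq_zero_of_prime_nsmul_eq_zero W p Ψ t hΨσ hsurj hq0 hq1 hker ht hpv
    κ.kerSubgroup hp2 hmult hIH
    (fun _ hg ↦ ZpExtension.mem_kerSubgroup.mpr
      (hg (κ.toContinuousMonoidHom.comp (absGaloisRestrict K (v.adicCompletion K)))))
    ht2 hφ hcong c hpc

end Vanishing

end Summit.BirchSwinnertonDyer.Rank1Residual.X2.LocalInertiaCohomologyMultiplicative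

end
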